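import Summits.MatrixMultiplication.MatrixMultiplication.Theorems.AbelianSTPPCensusTD2StatDefs

/-!
# T_D static certificate, second range `628 … 667` (t*-indexed linear checker with the k-member tree at `τ = 247/100`): kernel evaluation, the shape checks (one-member cover, else the k-member tree), volumes `1 … 332`

Cell mm-stpp (rung F-M1), tier T_D = «beat `2.47`»; checker in `AbelianSTPPCensusTD2StatDefs.lean`, table and bucket lists in `AbelianSTPPCensusTD2StatData.lean`
(pattern: theory g12's `AbelianSTPPCensusTAStatDDom*/DCk*.lean`).  `decide` with kernel reduction (standard axioms; no `native_decide`), `Elab.async false`;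
consumed by `TD2Stat.checkV_sound` / `TD2Stat.domV_sound` / `TD2Stat.m2V_sound` in the leaf `AbelianSTPPCensusLeafTD667Closed.lean`.
WHAT THIS IS NOT: arithmetic on shape lists only; no statement about STPP families or `ω`.
-/

set_option linter.dupNamespace false
set_option autoImplicit false
set_option Elab.async false

namespace Summit.MatrixMultiplication.MatrixMultiplication.Theorems.TD2Stat

set_option maxHeartbeats 0 in
/-- Check chunk: every sorted candidate shape of the volumes `1 … 232` passes `checkShape` (cost units 48696: (shape, bucket) cells and tree nodes). [original] -/
theorem ck1 : TD2Stat.checkV 232 1 = true := by decide +kernel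

set_option maxHeartbeats 0 in
/-- Check chunk: every sorted candidate shape of the volumes `233 … 332` passes `checkShape` (cost units 48897: (shape, bucket) cells and tree nodes). [original] -/
theorem ck233 : TD2Stat.checkV 100 233 = true := by decide +kernel

end Summit.MatrixMultiplication.MatrixMultiplication.Theorems.TD2Stat
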